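import Summits.HodgeConjecture.HodgeConjecture.Theses.LimitExtension
import Literature.AlgebraicGeometry.HodgeTheory.SupportedHodgeClassDescent
import Literature.AlgebraicGeometry.HodgeTheory.GysinKernelProofs
import Literature.AlgebraicGeometry.HodgeTheory.ComplexGysin
import Literature.AlgebraicGeometry.HodgeTheory.HypersurfaceSectionComplementMorse
import Literature.AlgebraicGeometry.HodgeTheory.LefschetzOperatorAlgebraicClasses
import Literature.AlgebraicGeometry.Resolution.ProjectiveResolutionProofs
import Literature.AlgebraicTopology.SingularHomology.UniversalCoefficientsField
import Literature.AlgebraicTopology.SingularHomology.GysinMapSupportProofs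

/-!
# Route LimitExtension · `MiddleDivisorSupportSuffices` (stmt-HodgeConjecture-10865):
# the assembly induction, closed modulo the Lefschetz-pencil step and two named facts

The item: `MiddleDivisorSupportSuffices := HodgeModels (inline) → MiddleDivisorSupport →
HodgeConjecture` — if every rational middle-degree Hodge class on every even-dimensional smooth
projective complex variety is supported on a divisor (`N¹H^{2p}`), the Hodge conjecture follows
(Thomas 2005, Prop. 2 with Thm. 1; de Cataldo–Migliorini 2009, §4; planned as the assembly chain
of route `NodalSupport`: `DivisorInduction`, `PencilReduction`, `HardLefschetzReduction`).

PROVED here (sorry-free, no definitions, no new named facts):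

* `restrictCompl_hypersurfaceSection_eq_zero_of_dim_lt`, `mem_supportedClasses_one_of_dim_lt` —
  **classes of degree `k > dim X` are supported on a divisor**, unconditionally: they die off every
  hypersurface section not containing `X`, because its complement is smooth affine of dimension
  `dim X` and has no homology in degree `k` (Andreotti–Frankel, Voisin II Thm. 1.22, the tree's
  `HypersurfaceSectionComplement.isZero_singularHomology_compl_range_hypersurfaceSectionι`, with
  universal coefficients over `ℂ`). Consequence: above the middle NO hard-Lefschetz input is
  needed — such classes enter the divisor step directly.
* `hodgeConjectureFor_of_descent_of_pencilReduction` — **the assembly induction** (strong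
  induction on the dimension, inner induction on the codimension): codimension `0` is
  `algebraicClasses X 0 = ⊤`; `0 < 2p < n` is the pencil step `hPen`; `2p = n` is
  `MiddleDivisorSupport` followed by the divisor descent `hDiv`; `2p > n` is
  `mem_supportedClasses_one_of_dim_lt` followed by `hDiv`.
* `middleDivisorSupportSuffices_of_descent_of_pencilReduction` — the item modulo `hDiv` + `hPen`;
  `descent_of_divisorInduction`, `middleDivisorSupportSuffices_of_nodalSupport` — the item from the
  verbatim bodies of route `NodalSupport`'s `DivisorInduction` (stmt-HodgeConjecture-1082) and
  `PencilReduction` (stmt-HodgeConjecture-1083) alone (`HardLefschetzReduction`,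
  stmt-HodgeConjecture-1084, is superfluous);
* `middleDivisorSupportSuffices_of_facts` — the item from the two NAMED FACTS behind the divisor
  descent (the tree's `supportedHodgeClassDescent_of`): Deligne, *Hodge III* Cor. 8.2.8
  `Deligne1974_ker_restrictCompl_eq_iSup_range_complexGysin` (reduced in `GysinKernelSplit` to its
  one open child, Prop. 8.2.7 `Deligne1974_ker_pullback_eq_ker_pullback_resolution`) and Voisin 2025
  Cor. 2.12 `Voisin2025_hodgeClass_lift_complexGysin` (reduced in `HodgeRiemannPolarizability` to
  the polarizability `smoothProjective_hodgeStructure_isPolarizable`, Hodge–Riemann), Hironaka,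
  the support property of Gysin maps and Poincaré duality being theorems of the tree — plus the
  pencil step `hPen`.

WHAT IS MISSING (the item stays open): the Lefschetz-pencil step below the middle, i.e. route
`NodalSupport`'s support item `PencilReduction` (stmt-HodgeConjecture-1083; Thomas 2005, proof of
Prop. 2, case `k < d/2`: Lefschetz pencil, relative Hilbert scheme + countability, multisection,
weak Lefschetz; the class `[𝒵] − r·σ^*c` vanishing on the smooth fibres is supported on the
singular fibres — `R^{2p-1}π_*` is constant by weak Lefschetz, so the `H¹(U, R^{2p-1})` part of
Leray carries no class coming from the compactification — and is handled by the divisor step).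
Products with projective spaces (BFNP 2009 Lemma 48, the tree's `middleDimensionReduction_holds`)
cannot replace it here: they trade a class below the middle for a middle class in HIGHER dimension,
which `MiddleDivisorSupport` + descent sends back to classes below the middle of the same cycle
dimension — a circle, not an induction.

CLOSING RECIPE: with `pen : …` a proof of the body of `NodalSupport.PencilReduction` and
`D_holds`, `V_holds` discharges of the two facts, append
`theorem middleDivisorSupportSuffices_proof : MiddleDivisorSupportSuffices :=
middleDivisorSupportSuffices_of_facts D_holds V_holds pen` (`--workitem stmt-HodgeConjecture-10865`)
and release the item `--by` it; with proofs `di`, `pen` of `NodalSupport.DivisorInduction` /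
`PencilReduction` instead, `middleDivisorSupportSuffices_of_nodalSupport di pen`.

## References

* [Thomas2005Nodes] R. P. Thomas, Nodes and the Hodge conjecture, J. Algebraic Geom. 14 (2005),
  Prop. 2 and its proof (arXiv:math/0212216, p. 4).
* [DecataldoMigliorini2009] M. A. de Cataldo, L. Migliorini, §4 Prop. 4.5 (arXiv:0711.1307).
* [VoisinHodgeII2003] C. Voisin, Hodge Theory and Complex Algebraic Geometry II (2003), §1.2.2
  Thm. 1.22–1.23.
* [DeligneHodgeIII1974] P. Deligne, Théorie de Hodge III, Publ. Math. IHÉS 44 (1974), Prop. 8.2.7,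
  Cor. 8.2.8.
* [Voisin2025] C. Voisin, Hodge and generalized Hodge conjectures, coniveau and algebraic cycles,
  J. Open Math. Probl. 1 (2025), Cor. 2.12, Thm. 4.4.
* [BrosnanFangNiePearlstein2009] P. Brosnan, H. Fang, Z. Nie, G. Pearlstein, Invent. Math. 177
  (2009), §6 Lemma 48.
-/

noncomputable section

-- the mandated namespace `Summit.HodgeConjecture.HodgeConjecture.Theorems` (Sub = Summit) trips
-- `linter.dupNamespace`; off tree-wide in the lakefile, restated for stand-alone elaboration.
set_option linter.dupNamespace false

open CategoryTheory AlgebraicGeometry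
open Literature.AlgebraicTopology.SingularHomology
open Literature.AlgebraicGeometry.Motives Literature.AlgebraicGeometry.HodgeTheory
open scoped Manifold

namespace Summit.HodgeConjecture.HodgeConjecture.Theorems

/-- **A class of degree above the dimension dies off every hypersurface section** (Andreotti–Frankel).
For `X ⊂ ℙᴺ` smooth projective of dimension `m + 1` (embedding `e`), a form `F` of degree `d ≥ 1`
and `k > m + 1`, every `c ∈ Hᵏ(X(ℂ); ℂ)` restricts to `0` on `(X ∖ X ∩ V₊(F))(ℂ)`: that complement
is smooth affine of dimension `m + 1`, so `H_k((X ∖ Y)(ℂ); ℂ) = 0` (Voisin II Thm. 1.22, the tree's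
`HypersurfaceSectionComplement.isZero_singularHomology_compl_range_hypersurfaceSectionι`), hence
`Hᵏ((X ∖ Y)(ℂ); ℂ) ↪ Hom(H_k, ℂ) = 0` (universal coefficients over a field).
[cite: VoisinHodgeII2003, §1.2.2 Thm. 1.22] [cite: HatcherAT2002, §3.1 Thm. 3.2] -/
theorem restrictCompl_hypersurfaceSection_eq_zero_of_dim_lt {m : ℕ} {X : SchemeOver ℂ}
    (hX : IsSmoothProjective (m + 1) X) (e : ProjectiveEmbedding X) {d : ℕ} (hd : 0 < d)
    (F : MvPolynomial (Fin (e.n + 1)) ℂ) (hF : F.IsHomogeneous d) {k : ℕ} (hk : m + 1 < k)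
    (c : complexBetti X k) :
    complexBetti.restrictCompl X (e.ι.left.base ⁻¹'
      (letI := MvPolynomial.gradedAlgebra (σ := Fin (e.n + 1)) (R := ℂ);
        ProjectiveSpectrum.zeroLocus (MvPolynomial.homogeneousSubmodule (Fin (e.n + 1)) ℂ) {F})) k c = 0 := by
  classical
  letI := MvPolynomial.gradedAlgebra (σ := Fin (e.n + 1)) (R := ℂ)
  -- the complex points off `X ∩ V₊(F)` are the complex points off the image of `Y(ℂ) → X(ℂ)`
  have hset : (Set.range (AlgPoints.map (L := ℂ) (e.hypersurfaceSectionι F hF)))ᶜ =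
      {P : ComplexPoints X | P.pt ∉ e.ι.left.base ⁻¹'
        ProjectiveSpectrum.zeroLocus (MvPolynomial.homogeneousSubmodule (Fin (e.n + 1)) ℂ) {F}} := by
    ext P
    rw [Set.mem_compl_iff, AlgPoints.mem_range_map_iff_pt_mem, Set.mem_setOf_eq,
      range_hypersurfaceSectionι e F hF hd]
    rfl
  -- Andreotti–Frankel: no homology of `(X ∖ Y)(ℂ)` in degree `k ≥ m + 2`
  have hAF : Limits.IsZero (singularHomology ℂ ℂ (complexPointsCompl X (e.ι.left.base ⁻¹'
      ProjectiveSpectrum.zeroLocus (MvPolynomial.homogeneousSubmodule (Fin (e.n + 1)) ℂ) {F})) k) := by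
    have h := HypersurfaceSectionComplement.isZero_singularHomology_compl_range_hypersurfaceSectionι
      (R := ℂ) (M₀ := ℂ) hX e hd F hF (j := k) (by omega)
    rw [hset] at h
    exact h
  haveI := ModuleCat.subsingleton_of_isZero hAF
  haveI := (kroneckerPairing_injective_of_field ℂ (complexPointsCompl X (e.ι.left.base ⁻¹'
      ProjectiveSpectrum.zeroLocus (MvPolynomial.homogeneousSubmodule (Fin (e.n + 1)) ℂ) {F})) k).subsingleton
  exact Subsingleton.elim _ _

/-- **Classes of degree above the dimension are supported on a divisor.** For `X` smooth
projective of dimension `n` over `ℂ` and `k > n`, every class `c ∈ Hᵏ(X(ℂ); ℂ)` lies in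
`N¹Hᵏ(X(ℂ); ℂ) = supportedClasses X k 1`: a hypersurface section `X ∩ V₊(F)` not containing `X` is
a proper closed subset of the irreducible `X`, of codimension `≥ 1` at each of its points
(`exists_hypersurfaceSection_forall_coheight`), and `c` dies off it
(`restrictCompl_hypersurfaceSection_eq_zero_of_dim_lt`). For `n = 0` there are no classes of
positive degree. [cite: VoisinHodgeII2003, §1.2.2 Thm. 1.22] [cite: Hartshorne1977, I Thm. 7.2] -/
theorem mem_supportedClasses_one_of_dim_lt {n : ℕ} {X : SchemeOver ℂ} (hX : IsSmoothProjective n X)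
    {k : ℕ} (hk : n < k) (c : complexBetti X k) : c ∈ supportedClasses X k 1 := by
  classical
  rcases Nat.eq_zero_or_eq_succ_pred n with h0 | hsucc
  · -- `n = 0`: `Hᵏ(X(ℂ); ℂ) = 0` for `k > 0 = 2 · 0`
    subst h0
    haveI := subsingleton_complexBetti hX (k := k) (by omega)
    rw [Subsingleton.elim c 0]
    exact Submodule.zero_mem _
  · rw [hsucc] at hX hk
    letI := MvPolynomial.gradedAlgebra
      (σ := Fin (hX.isProjectiveOver.projectiveEmbedding.n + 1)) (R := ℂ)
    obtain ⟨d, F, hd, hF, -, hcodim⟩ := exists_hypersurfaceSection_forall_coheight hX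
      hX.isProjectiveOver.projectiveEmbedding isClosed_univ (l := 0) (fun w _ ↦ by simp)
    exact mem_supportedClasses_of_restrictCompl_eq_zero
      ((ProjectiveSpectrum.isClosed_zeroLocus _ _).preimage
        hX.isProjectiveOver.projectiveEmbedding.ι.left.continuous)
      (fun z hz ↦ by exact_mod_cast hcodim z ⟨hz, Set.mem_univ z⟩)
      (restrictCompl_hypersurfaceSection_eq_zero_of_dim_lt hX _ hd F hF hk c)

/-! ### The assembly induction (Thomas 2005 Prop. 2 / de Cataldo–Migliorini 2009 §4, as in route
`NodalSupport`'s `Assembly`), with the divisor step and the pencil step as hypotheses -/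

/-- **The induction on the dimension.** Hypotheses, all in the tree's vocabulary:
* `hDiv` — DESCENT OF SUPPORTED HODGE CLASSES: on a smooth projective `X` of dimension `n`, granted
  the Hodge conjecture for all smooth projective varieties of dimension `< n`, a rational
  `(p,p)`-class supported on a divisor (`c ∈ N¹H²ᵖ = supportedClasses X (2p) 1`) is algebraic —
  verbatim the conclusion of the tree's `supportedHodgeClassDescent_of` (Deligne, Hodge III
  Cor. 8.2.8 + semisimplicity of polarisable Hodge structures, Voisin 2025 Cor. 2.12 + Hironaka +
  the Hodge conjecture downstairs + Gysin images of algebraic classes are algebraic), and implied by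
  route `NodalSupport`'s support `DivisorInduction` (`descent_of_divisorInduction`);
* `hPen` — THE LEFSCHETZ-PENCIL STEP BELOW THE MIDDLE, verbatim the body of route `NodalSupport`'s
  support item `PencilReduction` (stmt-HodgeConjecture-1083; Thomas 2005, proof of Prop. 2, case
  `k < d/2`: pencil, relative Hilbert scheme, multisection, weak Lefschetz): for `2 ≤ 2p ≤ m`, the
  Hodge conjecture in all codimensions for smooth projective `m`-folds plus the Hodge conjecture in
  codimension `p − 1` for `(m+1)`-folds give the Hodge conjecture in codimension `p` for
  `(m+1)`-folds;
* `hModels` — Hodge models exist (the route's support `HodgeModels`, inline);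
* `hMDS` — `MiddleDivisorSupport`: every rational middle-degree Hodge class on an even-dimensional
  smooth projective variety is supported on a divisor.
Conclusion: `HodgeConjectureFor n X` for every smooth projective `X` of every dimension `n`.
Proof: strong induction on `n`, inner induction on the codimension `p`: `p = 0` by
`algebraicClasses X 0 = ⊤`; `0 < 2p < n` by `hPen` (outer hypothesis in dimension `n − 1`, inner
hypothesis in codimension `p − 1`); `2p = n` by `hMDS` then `hDiv`; `2p > n` by
`mem_supportedClasses_one_of_dim_lt` (Andreotti–Frankel: such classes die off a hyperplane section)
then `hDiv` — so NO hard-Lefschetz input is needed above the middle.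
[cite: Thomas2005Nodes, Prop. 2 (proof)] [cite: DecataldoMigliorini2009, §4 Prop. 4.5]
[cite: VoisinHodgeII2003, §1.2.2 Thm. 1.22] -/
theorem hodgeConjectureFor_of_descent_of_pencilReduction
    (hDiv : ∀ ⦃n : ℕ⦄ ⦃X : SchemeOver ℂ⦄, IsSmoothProjective n X →
      (∀ ⦃m : ℕ⦄ ⦃Y : SchemeOver ℂ⦄, m < n → IsSmoothProjective m Y → HodgeConjectureFor m Y) →
      ∀ (p : ℕ) (c : singularCohomology ℂ ℂ (ComplexPoints X) (2 * p)),
        IsRationalClass c → IsOfHodgeType n X (2 * p) p p c → c ∈ supportedClasses X (2 * p) 1 →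
          c ∈ algebraicClasses X p)
    (hPen : ∀ (m p : ℕ), 1 ≤ p → 2 * p ≤ m →
      (∀ ⦃Y : SchemeOver ℂ⦄, IsSmoothProjective m Y → ∀ (q : ℕ) (c : complexBetti Y (2 * q)),
        IsRationalClass c → IsOfHodgeType m Y (2 * q) q q c → c ∈ algebraicClasses Y q) →
      (∀ ⦃X' : SchemeOver ℂ⦄, IsSmoothProjective (m + 1) X' →
        ∀ c : complexBetti X' (2 * (p - 1)), IsRationalClass c →
          IsOfHodgeType (m + 1) X' (2 * (p - 1)) (p - 1) (p - 1) c → c ∈ algebraicClasses X' (p - 1)) →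
      ∀ ⦃X : SchemeOver ℂ⦄, IsSmoothProjective (m + 1) X → ∀ c : complexBetti X (2 * p),
        IsRationalClass c → IsOfHodgeType (m + 1) X (2 * p) p p c → c ∈ algebraicClasses X p)
    (hModels : ∀ ⦃n : ℕ⦄ ⦃X : SchemeOver ℂ⦄, IsSmoothProjective n X → Nonempty (HodgeModel n X))
    (hMDS : Summit.HodgeConjecture.HodgeConjecture.Theses.LimitExtension.MiddleDivisorSupport) :
    ∀ (n : ℕ) ⦃X : SchemeOver ℂ⦄, IsSmoothProjective n X → HodgeConjectureFor n X := by
  intro n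
  induction n using Nat.strong_induction_on with
  | _ n ihn =>
  -- the cycle statement in dimension `n`, by induction on the codimension `p`
  have hcyc : ∀ (p : ℕ) ⦃X : SchemeOver ℂ⦄, IsSmoothProjective n X →
      ∀ c : complexBetti X (2 * p), IsRationalClass c → IsOfHodgeType n X (2 * p) p p c →
        c ∈ algebraicClasses X p := by
    intro p
    induction p with
    | zero => exact fun X _ c _ _ ↦ hodgeConjectureFor_codim_zero c
    | succ p' ihp =>
      intro X hX c hc hH
      have ih' : ∀ ⦃m : ℕ⦄ ⦃Y : SchemeOver ℂ⦄, m < n → IsSmoothProjective m Y →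
          HodgeConjectureFor m Y := fun m Y hm hY ↦ ihn m hm hY
      rcases Nat.lt_trichotomy (2 * (p' + 1)) n with hlt | heq | hgt
      · -- below the middle: the pencil step (`n = m + 1`, `2 (p'+1) ≤ m`)
        obtain ⟨m, rfl⟩ : ∃ m, n = m + 1 := ⟨n - 1, by omega⟩
        exact hPen m (p' + 1) (by omega) (by omega)
          (fun Y hY q c' hc' hH' ↦ (ihn m (Nat.lt_succ_self m) hY).2 q c' hc' hH')
          (fun X' hX' c' hc' hH' ↦ ihp hX' c' hc' hH') hX c hc hH
      · -- the middle: supported on a divisor by `hMDS`, then descent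
        subst heq
        exact hDiv hX ih' (p' + 1) c hc hH (hMDS (by omega) hX c hc hH)
      · -- above the middle: supported on a hyperplane section (Andreotti–Frankel), then descent
        exact hDiv hX ih' (p' + 1) c hc hH (mem_supportedClasses_one_of_dim_lt hX hgt c)
  exact fun X hX ↦ ⟨hModels hX, fun p c hc hH ↦ hcyc p hX c hc hH⟩

/-- **`MiddleDivisorSupportSuffices` modulo the divisor descent and the pencil step** (route
`LimitExtension`, item stmt-HodgeConjecture-10865): with `hDiv` (descent of supported Hodge
classes, the conclusion of `supportedHodgeClassDescent_of`) and `hPen` (route `NodalSupport`'s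
`PencilReduction`, stmt-HodgeConjecture-1083, verbatim), Hodge models and `MiddleDivisorSupport`
imply the Hodge conjecture. [cite: Thomas2005Nodes, Prop. 2 (proof)]
[cite: DecataldoMigliorini2009, §4 Prop. 4.5] -/
theorem middleDivisorSupportSuffices_of_descent_of_pencilReduction
    (hDiv : ∀ ⦃n : ℕ⦄ ⦃X : SchemeOver ℂ⦄, IsSmoothProjective n X →
      (∀ ⦃m : ℕ⦄ ⦃Y : SchemeOver ℂ⦄, m < n → IsSmoothProjective m Y → HodgeConjectureFor m Y) →
      ∀ (p : ℕ) (c : singularCohomology ℂ ℂ (ComplexPoints X) (2 * p)),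
        IsRationalClass c → IsOfHodgeType n X (2 * p) p p c → c ∈ supportedClasses X (2 * p) 1 →
          c ∈ algebraicClasses X p)
    (hPen : ∀ (m p : ℕ), 1 ≤ p → 2 * p ≤ m →
      (∀ ⦃Y : SchemeOver ℂ⦄, IsSmoothProjective m Y → ∀ (q : ℕ) (c : complexBetti Y (2 * q)),
        IsRationalClass c → IsOfHodgeType m Y (2 * q) q q c → c ∈ algebraicClasses Y q) →
      (∀ ⦃X' : SchemeOver ℂ⦄, IsSmoothProjective (m + 1) X' →
        ∀ c : complexBetti X' (2 * (p - 1)), IsRationalClass c →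
          IsOfHodgeType (m + 1) X' (2 * (p - 1)) (p - 1) (p - 1) c → c ∈ algebraicClasses X' (p - 1)) →
      ∀ ⦃X : SchemeOver ℂ⦄, IsSmoothProjective (m + 1) X → ∀ c : complexBetti X (2 * p),
        IsRationalClass c → IsOfHodgeType (m + 1) X (2 * p) p p c → c ∈ algebraicClasses X p) :
    Summit.HodgeConjecture.HodgeConjecture.Theses.LimitExtension.MiddleDivisorSupportSuffices := by
  unfold Summit.HodgeConjecture.HodgeConjecture.Theses.LimitExtension.MiddleDivisorSupportSuffices
  intro hModels hMDS n X hX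
  exact hodgeConjectureFor_of_descent_of_pencilReduction hDiv hPen hModels hMDS n hX

/-! ### The divisor descent from route `NodalSupport`'s `DivisorInduction`, and from the named facts -/

/-- **Route `NodalSupport`'s `DivisorInduction` (stmt-HodgeConjecture-1082, verbatim body) implies
the descent hypothesis `hDiv`**: in dimension `n' + 1` and codimension `p ≥ 1` it asks only for
the Hodge conjecture in codimension `p − 1` for `n'`-folds, which the full Hodge conjecture below
`n' + 1` supplies; in codimension `0` every class is algebraic, and a `0`-fold has no classes of
positive degree. [cite: DeligneHodgeIII1974, Cor. 8.2.8] [cite: Voisin2025, Cor. 2.12 (p. 24)] -/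
theorem descent_of_divisorInduction
    (hDI : ∀ (n p : ℕ), 1 ≤ p →
      (∀ ⦃Y : SchemeOver ℂ⦄, IsSmoothProjective n Y → ∀ c : complexBetti Y (2 * (p - 1)),
        IsRationalClass c → IsOfHodgeType n Y (2 * (p - 1)) (p - 1) (p - 1) c →
          c ∈ algebraicClasses Y (p - 1)) →
      ∀ ⦃X : SchemeOver ℂ⦄, IsSmoothProjective (n + 1) X → ∀ c : complexBetti X (2 * p),
        IsRationalClass c → IsOfHodgeType (n + 1) X (2 * p) p p c →
          c ∈ supportedClasses X (2 * p) 1 → c ∈ algebraicClasses X p) :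
    ∀ ⦃n : ℕ⦄ ⦃X : SchemeOver ℂ⦄, IsSmoothProjective n X →
      (∀ ⦃m : ℕ⦄ ⦃Y : SchemeOver ℂ⦄, m < n → IsSmoothProjective m Y → HodgeConjectureFor m Y) →
      ∀ (p : ℕ) (c : singularCohomology ℂ ℂ (ComplexPoints X) (2 * p)),
        IsRationalClass c → IsOfHodgeType n X (2 * p) p p c → c ∈ supportedClasses X (2 * p) 1 →
          c ∈ algebraicClasses X p := by
  intro n X hX ih p c hc hH hsupp
  rcases Nat.eq_zero_or_pos p with rfl | hp
  · exact hodgeConjectureFor_codim_zero c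
  rcases Nat.eq_zero_or_eq_succ_pred n with h0 | hsucc
  · -- a `0`-fold carries no classes of positive degree
    subst h0
    haveI := subsingleton_complexBetti hX (k := 2 * p) (by omega)
    rw [Subsingleton.elim c 0]
    exact Submodule.zero_mem _
  · rw [hsucc] at hX hH ih
    obtain ⟨p', rfl⟩ : ∃ p', p = p' + 1 := ⟨p - 1, by omega⟩
    exact hDI n.pred (p' + 1) hp
      (fun Y hY c' hc' hH' ↦ (ih (Nat.lt_succ_self _) hY).2 p' c' hc' hH') hX c hc hH hsupp

/-- **`MiddleDivisorSupportSuffices` from route `NodalSupport`'s supports `DivisorInduction`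
(stmt-HodgeConjecture-1082) and `PencilReduction` (stmt-HodgeConjecture-1083), verbatim bodies** —
the planner's intended assembly; `HardLefschetzReduction` (stmt-HodgeConjecture-1084) is not needed
(classes above the middle die off a hyperplane section by Andreotti–Frankel and are handled by the
divisor step). CLOSING RECIPE: when both items are proved (`…Theorems.<x> : NodalSupport.DivisorInduction`,
`…Theorems.<y> : NodalSupport.PencilReduction`, definitionally these bodies), append
`theorem middleDivisorSupportSuffices_proof : MiddleDivisorSupportSuffices :=
middleDivisorSupportSuffices_of_nodalSupport <x> <y>` (`--workitem stmt-HodgeConjecture-10865`).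
[cite: Thomas2005Nodes, Prop. 2 (proof)] [cite: DecataldoMigliorini2009, §4 Prop. 4.5] -/
theorem middleDivisorSupportSuffices_of_nodalSupport
    (hDI : ∀ (n p : ℕ), 1 ≤ p →
      (∀ ⦃Y : SchemeOver ℂ⦄, IsSmoothProjective n Y → ∀ c : complexBetti Y (2 * (p - 1)),
        IsRationalClass c → IsOfHodgeType n Y (2 * (p - 1)) (p - 1) (p - 1) c →
          c ∈ algebraicClasses Y (p - 1)) →
      ∀ ⦃X : SchemeOver ℂ⦄, IsSmoothProjective (n + 1) X → ∀ c : complexBetti X (2 * p),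
        IsRationalClass c → IsOfHodgeType (n + 1) X (2 * p) p p c →
          c ∈ supportedClasses X (2 * p) 1 → c ∈ algebraicClasses X p)
    (hPen : ∀ (m p : ℕ), 1 ≤ p → 2 * p ≤ m →
      (∀ ⦃Y : SchemeOver ℂ⦄, IsSmoothProjective m Y → ∀ (q : ℕ) (c : complexBetti Y (2 * q)),
        IsRationalClass c → IsOfHodgeType m Y (2 * q) q q c → c ∈ algebraicClasses Y q) →
      (∀ ⦃X' : SchemeOver ℂ⦄, IsSmoothProjective (m + 1) X' →
        ∀ c : complexBetti X' (2 * (p - 1)), IsRationalClass c →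
          IsOfHodgeType (m + 1) X' (2 * (p - 1)) (p - 1) (p - 1) c → c ∈ algebraicClasses X' (p - 1)) →
      ∀ ⦃X : SchemeOver ℂ⦄, IsSmoothProjective (m + 1) X → ∀ c : complexBetti X (2 * p),
        IsRationalClass c → IsOfHodgeType (m + 1) X (2 * p) p p c → c ∈ algebraicClasses X p) :
    Summit.HodgeConjecture.HodgeConjecture.Theses.LimitExtension.MiddleDivisorSupportSuffices :=
  middleDivisorSupportSuffices_of_descent_of_pencilReduction (descent_of_divisorInduction hDI) hPen

/-- **`MiddleDivisorSupportSuffices` from two named facts of the tree and the pencil step.** The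
divisor descent `hDiv` is the tree's `supportedHodgeClassDescent_of`, fed with: Deligne's
*Hodge III* Cor. 8.2.8 (`hD`, the named fact `Deligne1974_ker_restrictCompl_eq_iSup_range_complexGysin`;
its one open child is Prop. 8.2.7, `Deligne1974_ker_pullback_eq_ker_pullback_resolution`, file
`GysinKernelSplit`), Voisin 2025 Cor. 2.12 (`hV`, the named fact
`Voisin2025_hodgeClass_lift_complexGysin`; its one open input is the polarizability
`smoothProjective_hodgeStructure_isPolarizable`, Hodge–Riemann, file `HodgeRiemannPolarizability`),
and the THEOREMS projective Hironaka (`Hironaka1964_projective_holds`), the support property of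
Gysin maps (`gysinMap_restrictCompl_eq_zero_of_field ℂ`) and Poincaré duality for an orientation
family (`OrientationFamily.hasPoincareDuality`). What remains hypothetical: `hD`, `hV`, and the
pencil step `hPen` (route `NodalSupport`'s `PencilReduction`, stmt-HodgeConjecture-1083).
CLOSING RECIPE: with discharges `D_holds`, `V_holds` of the two facts and `pen : …` (a proof of
the body of `NodalSupport.PencilReduction`), append `theorem middleDivisorSupportSuffices_proof :
MiddleDivisorSupportSuffices := middleDivisorSupportSuffices_of_facts D_holds V_holds pen`
(`--workitem stmt-HodgeConjecture-10865`) and release the item `--by` it.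
[cite: DeligneHodgeIII1974, Prop. 8.2.7 and Cor. 8.2.8] [cite: Voisin2025, Cor. 2.12 (p. 24), Thm. 4.4 (p. 38)]
[cite: VoisinHodgeI2002, Thm. 6.32 and §7.1.2] [cite: Thomas2005Nodes, Prop. 2 (proof)] -/
theorem middleDivisorSupportSuffices_of_facts
    (hD : Deligne1974_ker_restrictCompl_eq_iSup_range_complexGysin)
    (hV : Voisin2025_hodgeClass_lift_complexGysin)
    (hPen : ∀ (m p : ℕ), 1 ≤ p → 2 * p ≤ m →
      (∀ ⦃Y : SchemeOver ℂ⦄, IsSmoothProjective m Y → ∀ (q : ℕ) (c : complexBetti Y (2 * q)),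
        IsRationalClass c → IsOfHodgeType m Y (2 * q) q q c → c ∈ algebraicClasses Y q) →
      (∀ ⦃X' : SchemeOver ℂ⦄, IsSmoothProjective (m + 1) X' →
        ∀ c : complexBetti X' (2 * (p - 1)), IsRationalClass c →
          IsOfHodgeType (m + 1) X' (2 * (p - 1)) (p - 1) (p - 1) c → c ∈ algebraicClasses X' (p - 1)) →
      ∀ ⦃X : SchemeOver ℂ⦄, IsSmoothProjective (m + 1) X → ∀ c : complexBetti X (2 * p),
        IsRationalClass c → IsOfHodgeType (m + 1) X (2 * p) p p c → c ∈ algebraicClasses X p) :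
    Summit.HodgeConjecture.HodgeConjecture.Theses.LimitExtension.MiddleDivisorSupportSuffices :=
  let μ : OrientationFamily := fun _ _ h ↦ Classical.choice (ComplexPoints.isOrientableOver ℂ h)
  middleDivisorSupportSuffices_of_descent_of_pencilReduction
    (supportedHodgeClassDescent_of hD hV
      Literature.AlgebraicGeometry.Resolution.Hironaka1964_projective_holds
      (gysinMap_restrictCompl_eq_zero_of_field ℂ) ⟨μ, μ.hasPoincareDuality⟩)
    hPen

end Summit.HodgeConjecture.HodgeConjecture.Theorems

end
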